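import Literature.MathematicalPhysics.QuantumFieldTheory.Balaban1983to89.Node00.N24GlueStage8
import Literature.MathematicalPhysics.QuantumFieldTheory.Balaban1983to89.B16NodeKnitRecordPinned

/-!
# NODE N24 · THE N13 KNITS RE-ISSUED ON THE PINNED 𝐑-SLOT (referee dag-ref-D flag F-n24T-1, READS #32 ∕ #38; seat dag-n13-a's repair
# `B16NodeKnitRecordPinned.b16_main_reExp_of_isRecordOfRecord₅C_pinned ∕ …₅_pinned`, p414943): drop-in `_pinned` twins of the N24 knit theorems of modules 6, 7, 9, 10
# at `₅`, `₅C` and `₈C`, with `hR : ∀ P, (w.up P).rOperation` — the binding world's OWN [Balaban1989LargeFieldII] Thm-1-for-𝐑 leaf — replacing the θ-form (R₅) slot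

TRACK A (YM-PLAN §2d, node N24 of 28), seat `pub-ymgap-dag-n24-a` (-a KNIT-BY-NAME).  ELEVENTH N24 module, a NEW importing one (append-only growth; nothing in modules
1–10 is edited — their theorems stay correct implications).  THE DEFECT (kernel-certified by ref-D's `RefDProbe.hR_unsat` and, in the tree, by n13-a's
`B16NodeKnitRecordPinned.not_forall_atDatum_rOpLeaf₅C ∕ ₅`): the (R₅) slot of the N13 re-exponent knits in the θ-form
«`hR : ∀ θ, θ.Admissible → D = datumOfRecord₅ F N θ → ∀ P, ROpLeaf (θ.res.V P)`» carries NO pin clause — the residual 𝐑-carrier `V` is free and the datum is blind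
to it (`datumOfRecord₅_updV`), so at EVERY Stage-5 record some admissible `θ'` over the same datum has a failing leaf: the slot is unsatisfiable, and every N24
theorem displaying it (`N24KnitStage5.N24_at_record₅_knit₁₁₁₃{,_of_prop26}`, `N24_binders₅_after_knit`; `N24GlueThreshold.N24_at_record₅C_knit₁₃{,_of_prop26}`;
`N24KnitStage5C.N24_at_record₅C_knit₀₈₁₀₁₁₁₃{,_of_prop26}`, `N24_binders₅C_after_knit`; `N24GlueStage8.N24_at_record₈C_knit₀₈₁₀₁₁₁₃`, `N24_at_record₈C_knit_of_betaMerged`,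
`N24_binders₈C_after_knit`) holds from `h` + `hR` alone — correct but VACUOUS (A1), uninformative as a «which child blocks» census.  THE REPAIR (n13-a, adopted
here verbatim): read (R) at THE WORLD'S LEAF, `hR : ∀ P : B12.RunParams, (w.up P).rOperation` — satisfiable per record, equivalent at a record to the pinned
θ-form (`B16NodeKnitRecordPinned.forall_pinned_rOpLeaf_iff_rOperation₅C`), and exactly the node's own 𝐑-antecedent (dischargeable once Stage ₉ pins `V` by the
represented tower, `B16NodeKnitRepTower` §2).  Every other slot of the knits already carries the record's pin clause `(∀ P, w.up P = upOfRecord₅C F N θ P) →`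
(N08 ∕ N10 ∕ N11) or reads only `D.C` (`hcor`) — ref-D READ #38: genuine.  THEOREMS ONLY, def-free, sorry-free, standard axioms.

WHAT THIS FILE PROVES — §0 `N24_exists_isRecordOfRecord₅C_rOperation`: the repaired slot IS satisfiable at a record (A1 witness, degenerate `K = 0` carrier;
nothing of Bałaban's asserted); then the `_pinned` twins, each ONE composition by name with `B16NodeKnitRecordPinned.b16_main_reExp_of_isRecordOfRecord₅{C}_pinned eM eP h hR hcor`
as the N13 witness of `N24_at_record₅{C}_of_N13_exists`:
§1 at `₅`  — `N24_at_record₅_knit₁₁₁₃_pinned`, `…_of_prop26_pinned`, `N24_binders₅_after_knit_pinned` (module 6's three);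
§2 at `₅C` — `N24_at_record₅C_knit₁₃_pinned`, `…_of_prop26_pinned` (module 7 §2), `N24_at_record₅C_knit₀₈₁₀₁₁₁₃_pinned`, `…_of_prop26_pinned`, `N24_binders₅C_after_knit_pinned`
   (module 9);
§3 at `₈C` — `N24_at_record₈C_knit₀₈₁₀₁₁₁₃_pinned`, `N24_at_record₈C_knit_of_betaMerged_pinned`, `N24_binders₈C_after_knit_pinned` (module 10).
WHICH CHILD BLOCKS (unchanged lists, now displayed with a satisfiable 𝐑-slot): THEOREMS — N01 N02 N04 N23, `hC`, `hγ`, guarded (0.20); BY NAME MODULO SLOTS — N03 (Prop.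
2.6 census), N08 (B10₅), N10 (B13₅), N11 ((P1₅) (P3₅) (S0) (S1)), N13 ((R) := the world's leaf `∀ P, (w.up P).rOperation` + the five Cor.-3 leaves at `(w.γ, e₋ D, e₊ D)`;
residue = Stage ₉'s represented tower); PURE BINDERS — N05 N06 N07 N09 N12; β-side — box bounds on `D.βfun` (₅∕₅C) resp. on the merged β of record (₈C).
HONEST FRAMING: kernel bookkeeping BY NAME; every slot a displayed HYPOTHESIS, nothing of Bałaban's asserted; N24 COMPOSITE — no discharge, no count; one finite T⁴
programme at fixed ε; NOT continuum ∕ ℝ⁴ ∕ OS ∕ mass gap ∕ Clay.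
-/

noncomputable section

open scoped Matrix.Norms.L2Operator

namespace Literature.MathematicalPhysics.QuantumFieldTheory.Balaban1983to89.Node00

open DagBinding T4Continuum T4DatumAssembly FlowStepRuns AveragingRT

/-! ## §0. The pinned 𝐑-slot is SATISFIABLE at a record (A1 witness for the repaired slot; DEGENERATE carrier, `K = 0`) -/

/-- **The world-leaf 𝐑-slot is satisfiable jointly with the record predicate of record**: on every four-torus family, at every `N`, some `₅C` record `(D, w)`
has `(w.up P).rOperation` at every run — witness: module 7's junk datum (admissible Stage-3 parameters, `γ := 1`, trivial residual) with the residual 𝐑-carrier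
the DEGENERATE `K = 0` bundle (gauge group `U(1)`, identity 𝐑, `True` side conditions), whose p. 244 leaf holds vacuously.  Contrast: the θ-form slot is
satisfiable at NO record (`B16NodeKnitRecordPinned.not_forall_atDatum_rOpLeaf₅C`).  A typing witness, NOT an object of record; nothing of Bałaban's asserted.
[cite: Balaban1988Convergent, p.244 (the assumed 𝐑; bookkeeping witness, no estimate)] -/
theorem N24_exists_isRecordOfRecord₅C_rOperation (F : T4Family) (N : ℕ) [NeZero N] :
    ∃ (D : FiniteEpsData F (SU N)) (w : WorldP), IsRecordOfRecord₅C F N D w ∧ ∀ P : B12.RunParams, (w.up P).rOperation := by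
  obtain ⟨θ₃, hθ₃, -⟩ := N24_exists_stage3Params
  obtain ⟨X⟩ := nonempty_printedCarriersR
  obtain ⟨Y⟩ := nonempty_printedCarriers9X
  obtain ⟨Z⟩ := nonempty_printedCarriers11
  obtain ⟨Q⟩ := nonempty_params
  obtain ⟨W⟩ := nonempty_printedCarriers15
  obtain ⟨w₀⟩ := nonempty_worldP
  let V : PrintedCarriers14R :=
    { P := Q, G := ↥(Matrix.unitaryGroup (Fin 1) ℂ), instGG := inferInstance, instMS := inferInstance, instHD := inferInstance,
      K := 0, R := fun _ ρ => ρ, Scorr := fun _ _ => True, S := fun _ _ => True }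
  have hV : ROpLeaf V := fun k hk => absurd hk (Nat.not_lt_zero k)
  let res : Residual₅ F N :=
    { X := fun _ => X, Y := fun _ => Y, Z := fun _ => Z, V := fun _ => V, W := fun _ => W, βfun := fun _ _ => 0, E := fun _ => 0,
      dom := fun _ _ => ∅, effAction := fun _ _ _ => 0, wilsonBG := fun _ _ _ => 0, Ek := fun _ _ _ => 0, χ := fun _ _ _ => 0,
      S218 := fun _ _ _ => False, ReprA := fun _ _ _ _ _ _ _ => False, IndA := fun _ _ _ _ _ _ _ => False, R := fun _ _ => id,
      preservesIntegral_R := fun _ _ _ _ => rfl, integrable_R := fun _ _ _ _ h => h }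
  let θ : Stage5Params F N := { θ₃ with γ := 1, res := res }
  have hθ : θ.Admissible := ⟨hθ₃, one_pos⟩
  let w : WorldP :=
    { w₀ with
      C := (datumOfRecord₅ F N θ).C, γ := θ.γ, L := (θ.L : ℝ), one_lt_L := by exact_mod_cast θ₃.hL.2
      up := fun P => upOfRecord₅C F N θ P }
  refine ⟨datumOfRecord₅ F N θ, w, isRecordOfRecord₅C_of_eq F N θ hθ w rfl rfl rfl (fun _ => rfl), fun P => ?_⟩
  exact (B14NodeKnitRecord5C.rOperation_iff_rOpLeaf_res_C F N θ w P rfl).2 hV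

variable {F : T4Family} {N : ℕ} [NeZero N] {D : FiniteEpsData F (SU N)} {w : WorldP}

/-! ## §1. At the N-binding `₅` (module 6's knits, 𝐑-slot pinned) -/

/-- **Module 6's `N24_at_record₅_knit₁₁₁₃` with the 𝐑-slot PINNED**: N11's slots verbatim; N13 from datum-indexed exponent families `eM eP`, the world's own 𝐑-leaf
`hR : ∀ P, (w.up P).rOperation` and the five Cor.-3 leaves (`B16NodeKnitRecordPinned.b16_main_reExp_of_isRecordOfRecord₅_pinned`); the β-box bounds on `D.βfun`.
[cite: Balaban1989LargeFieldII, Thm 1 p.355 + pp.387, 391; Balaban1988Convergent, Thm 1 p.262, Theorem p.245, p.244, Cor. 3 (2.50) p.264; Balaban1987RG1, (1.22) p.264 (bookkeeping)] -/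
theorem N24_at_record₅_knit₁₁₁₃_pinned (h : IsRecordOfRecord₅ F N D w) {γ₀ : ℝ} (hγ₀ : w.γ ≤ γ₀)
    (h03 : ∀ P : B12.RunParams, Dag.B6_main (leavesP w P)) (h05 : ∀ P : B12.RunParams, Dag.B8_main (leavesP w P))
    (h06 : ∀ P : B12.RunParams, Dag.B9_main (leavesP w P)) (h07 : ∀ P : B12.RunParams, Dag.B11_main (leavesP w P))
    (h08 : ∀ P : B12.RunParams, Dag.B10_main (leavesP w P)) (h09 : ∀ P : B12.RunParams, Dag.B12_main (leavesP w P))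
    (h10 : ∀ P : B12.RunParams, Dag.B13_main (leavesP w P)) (h12 : ∀ P : B12.RunParams, Dag.B15_main (leavesP w P))
    (slots₁₁ : ∀ θ : Stage5Params F N, θ.Admissible → D = datumOfRecord₅ F N θ →
      (∀ P, w.up P = upOfRecord₅ F N θ P) → ∀ P : B12.RunParams,
        ∃ S Scorr : (k : ℕ) → Density (F.P P.K) k (SU N) → Prop,
          (ROpLeaf (θ.res.V P) → B14.RAssumedP244 (θ.res.R P) Scorr S P.K) ∧
          (∀ k, k ≤ P.K → S k (densOfRecord₅ F N θ P k) → θ.res.S218 P k (densOfRecord₅ F N θ P k)) ∧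
          ((leavesP w P).smallCouplings → S 0 (rhoZeroOfRecord F N P.K P.g0 (θ.res.E P))) ∧
          ((leavesP w P).b7 → (leavesP w P).b8 → (leavesP w P).b9 → (leavesP w P).b10 → (leavesP w P).b11 →
            (leavesP w P).smallCouplings → (leavesP w P).smallFieldInductive → (leavesP w P).flowControl →
              ∀ k, k < P.K → S k (densOfRecord₅ F N θ P k) →
                Scorr (k + 1) (TrhoOfRecord F N P.K k (densOfRecord₅ F N θ P k))))
    (eM eP : FiniteEpsData F (SU N) → ℝ → ℝ) (hR : ∀ P : B12.RunParams, (w.up P).rOperation)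
    (hcor : ∀ θ : Stage5Params F N, θ.Admissible → D = datumOfRecord₅ F N θ →
      ∃ R : B14Cor3.ReprFamily (datumOfRecord₅ F N θ).C,
        B14Cor3.LeafH (datumOfRecord₅ F N θ).C R w.γ ∧ B14Cor3.LeafU1 (datumOfRecord₅ F N θ).C R w.γ ∧
        B14Cor3.LeafU2 (datumOfRecord₅ F N θ).C R w.γ (eP D) ∧ B14Cor3.LeafL1 (datumOfRecord₅ F N θ).C R w.γ ∧
        B14Cor3.LeafL2 (datumOfRecord₅ F N θ).C R w.γ (eM D))
    (hlo : FlowStep.BetaLowerH w.b γ₀ D.βfun) (hhi : FlowStep.BetaUpperH w.βup γ₀ D.βfun) :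
    B16.EndStatementBPrinted D.C :=
  N24_at_record₅_of_N13_exists h hγ₀ h03 h05 h06 h07 h08 h09 h10
    (B14NodeKnitRecord5.b14_main_of_isRecordOfRecord₅ h slots₁₁) h12
    ⟨eM D, eP D, B16NodeKnitRecordPinned.b16_main_reExp_of_isRecordOfRecord₅_pinned eM eP h hR hcor⟩ hlo hhi

/-- Module 6's `N24_at_record₅_knit₁₁₁₃_of_prop26` with the 𝐑-slot pinned (N03 at its Prop. 2.6 census). [cite: Balaban1989LargeFieldII, Thm 1 p.355 + p.391; Balaban1984PropagatorsII, Prop. 2.6 (2.136)–(2.140) p.247; Balaban1988Convergent, Thm 1 p.262, Cor. 3 (2.50) p.264 (bookkeeping)] -/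
theorem N24_at_record₅_knit₁₁₁₃_of_prop26_pinned (h : IsRecordOfRecord₅ F N D w) {γ₀ : ℝ} (hγ₀ : w.γ ≤ γ₀)
    (h26 : ∀ θ : Stage3Params, θ.toStage1Params.Admissible →
      B6.Prop26Printed (fun i : B6KLevelCensusIndexV1.KIdx θ.d₆ θ.ℓ₆ θ.hd' θ.hL' θ.b₀ θ.b₁ => B6KLevelCensusIndexV1.kGeoG i)
        (fun i => B6Prop26Census2136KLevelV1.kG i))
    (h05 : ∀ P : B12.RunParams, Dag.B8_main (leavesP w P))
    (h06 : ∀ P : B12.RunParams, Dag.B9_main (leavesP w P)) (h07 : ∀ P : B12.RunParams, Dag.B11_main (leavesP w P))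
    (h08 : ∀ P : B12.RunParams, Dag.B10_main (leavesP w P)) (h09 : ∀ P : B12.RunParams, Dag.B12_main (leavesP w P))
    (h10 : ∀ P : B12.RunParams, Dag.B13_main (leavesP w P)) (h12 : ∀ P : B12.RunParams, Dag.B15_main (leavesP w P))
    (slots₁₁ : ∀ θ : Stage5Params F N, θ.Admissible → D = datumOfRecord₅ F N θ →
      (∀ P, w.up P = upOfRecord₅ F N θ P) → ∀ P : B12.RunParams,
        ∃ S Scorr : (k : ℕ) → Density (F.P P.K) k (SU N) → Prop,
          (ROpLeaf (θ.res.V P) → B14.RAssumedP244 (θ.res.R P) Scorr S P.K) ∧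
          (∀ k, k ≤ P.K → S k (densOfRecord₅ F N θ P k) → θ.res.S218 P k (densOfRecord₅ F N θ P k)) ∧
          ((leavesP w P).smallCouplings → S 0 (rhoZeroOfRecord F N P.K P.g0 (θ.res.E P))) ∧
          ((leavesP w P).b7 → (leavesP w P).b8 → (leavesP w P).b9 → (leavesP w P).b10 → (leavesP w P).b11 →
            (leavesP w P).smallCouplings → (leavesP w P).smallFieldInductive → (leavesP w P).flowControl →
              ∀ k, k < P.K → S k (densOfRecord₅ F N θ P k) →
                Scorr (k + 1) (TrhoOfRecord F N P.K k (densOfRecord₅ F N θ P k))))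
    (eM eP : FiniteEpsData F (SU N) → ℝ → ℝ) (hR : ∀ P : B12.RunParams, (w.up P).rOperation)
    (hcor : ∀ θ : Stage5Params F N, θ.Admissible → D = datumOfRecord₅ F N θ →
      ∃ R : B14Cor3.ReprFamily (datumOfRecord₅ F N θ).C,
        B14Cor3.LeafH (datumOfRecord₅ F N θ).C R w.γ ∧ B14Cor3.LeafU1 (datumOfRecord₅ F N θ).C R w.γ ∧
        B14Cor3.LeafU2 (datumOfRecord₅ F N θ).C R w.γ (eP D) ∧ B14Cor3.LeafL1 (datumOfRecord₅ F N θ).C R w.γ ∧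
        B14Cor3.LeafL2 (datumOfRecord₅ F N θ).C R w.γ (eM D))
    (hlo : FlowStep.BetaLowerH w.b γ₀ D.βfun) (hhi : FlowStep.BetaUpperH w.βup γ₀ D.βfun) :
    B16.EndStatementBPrinted D.C :=
  N24_at_record₅_knit₁₁₁₃_pinned h hγ₀ (b6_main_of_isRecordOfRecord₅_of_prop26 h26 h) h05 h06 h07 h08 h09 h10 h12 slots₁₁ eM eP hR hcor
    hlo hhi

/-- Module 6's «which child blocks» at `₅` with the 𝐑-slot pinned: the SEVEN pure binders N05–N10, N12 ⇒ (B2), given N03's census, N11's slots, N13's world-leaf 𝐑 +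
exponent families + Cor.-3 leaves and the β-box. [cite: Balaban1989LargeFieldII, Thm 1 p.355 + p.391 (bookkeeping)] -/
theorem N24_binders₅_after_knit_pinned (h : IsRecordOfRecord₅ F N D w) {γ₀ : ℝ} (hγ₀ : w.γ ≤ γ₀)
    (h26 : ∀ θ : Stage3Params, θ.toStage1Params.Admissible →
      B6.Prop26Printed (fun i : B6KLevelCensusIndexV1.KIdx θ.d₆ θ.ℓ₆ θ.hd' θ.hL' θ.b₀ θ.b₁ => B6KLevelCensusIndexV1.kGeoG i)
        (fun i => B6Prop26Census2136KLevelV1.kG i))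
    (slots₁₁ : ∀ θ : Stage5Params F N, θ.Admissible → D = datumOfRecord₅ F N θ →
      (∀ P, w.up P = upOfRecord₅ F N θ P) → ∀ P : B12.RunParams,
        ∃ S Scorr : (k : ℕ) → Density (F.P P.K) k (SU N) → Prop,
          (ROpLeaf (θ.res.V P) → B14.RAssumedP244 (θ.res.R P) Scorr S P.K) ∧
          (∀ k, k ≤ P.K → S k (densOfRecord₅ F N θ P k) → θ.res.S218 P k (densOfRecord₅ F N θ P k)) ∧
          ((leavesP w P).smallCouplings → S 0 (rhoZeroOfRecord F N P.K P.g0 (θ.res.E P))) ∧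
          ((leavesP w P).b7 → (leavesP w P).b8 → (leavesP w P).b9 → (leavesP w P).b10 → (leavesP w P).b11 →
            (leavesP w P).smallCouplings → (leavesP w P).smallFieldInductive → (leavesP w P).flowControl →
              ∀ k, k < P.K → S k (densOfRecord₅ F N θ P k) →
                Scorr (k + 1) (TrhoOfRecord F N P.K k (densOfRecord₅ F N θ P k))))
    (eM eP : FiniteEpsData F (SU N) → ℝ → ℝ) (hR : ∀ P : B12.RunParams, (w.up P).rOperation)
    (hcor : ∀ θ : Stage5Params F N, θ.Admissible → D = datumOfRecord₅ F N θ →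
      ∃ R : B14Cor3.ReprFamily (datumOfRecord₅ F N θ).C,
        B14Cor3.LeafH (datumOfRecord₅ F N θ).C R w.γ ∧ B14Cor3.LeafU1 (datumOfRecord₅ F N θ).C R w.γ ∧
        B14Cor3.LeafU2 (datumOfRecord₅ F N θ).C R w.γ (eP D) ∧ B14Cor3.LeafL1 (datumOfRecord₅ F N θ).C R w.γ ∧
        B14Cor3.LeafL2 (datumOfRecord₅ F N θ).C R w.γ (eM D))
    (hlo : FlowStep.BetaLowerH w.b γ₀ D.βfun) (hhi : FlowStep.BetaUpperH w.βup γ₀ D.βfun) :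
    ((∀ P : B12.RunParams, Dag.B8_main (leavesP w P)) → (∀ P : B12.RunParams, Dag.B9_main (leavesP w P)) →
      (∀ P : B12.RunParams, Dag.B11_main (leavesP w P)) → (∀ P : B12.RunParams, Dag.B10_main (leavesP w P)) →
      (∀ P : B12.RunParams, Dag.B12_main (leavesP w P)) → (∀ P : B12.RunParams, Dag.B13_main (leavesP w P)) →
      (∀ P : B12.RunParams, Dag.B15_main (leavesP w P)) → B16.EndStatementBPrinted D.C) :=
  fun h05 h06 h07 h08 h09 h10 h12 =>
    N24_at_record₅_knit₁₁₁₃_of_prop26_pinned h hγ₀ h26 h05 h06 h07 h08 h09 h10 h12 slots₁₁ eM eP hR hcor hlo hhi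

/-! ## §2. At the record predicate of record `₅C` (modules 7 §2 and 9, 𝐑-slot pinned) -/

/-- **Module 7's `N24_at_record₅C_knit₁₃` with the 𝐑-slot PINNED** (N13 by name at `₅C` via `B16NodeKnitRecordPinned.b16_main_reExp_of_isRecordOfRecord₅C_pinned`).
[cite: Balaban1989LargeFieldII, Thm 1 p.355 + pp.387, 391; Balaban1988Convergent, p.244, Cor. 3 (2.50) p.264; Balaban1987RG1, (1.22) p.264 (bookkeeping)] -/
theorem N24_at_record₅C_knit₁₃_pinned (h : IsRecordOfRecord₅C F N D w) {γ₀ : ℝ} (hγ₀ : w.γ ≤ γ₀)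
    (h03 : ∀ P : B12.RunParams, Dag.B6_main (leavesP w P)) (h05 : ∀ P : B12.RunParams, Dag.B8_main (leavesP w P))
    (h06 : ∀ P : B12.RunParams, Dag.B9_main (leavesP w P)) (h07 : ∀ P : B12.RunParams, Dag.B11_main (leavesP w P))
    (h08 : ∀ P : B12.RunParams, Dag.B10_main (leavesP w P)) (h09 : ∀ P : B12.RunParams, Dag.B12_main (leavesP w P))
    (h10 : ∀ P : B12.RunParams, Dag.B13_main (leavesP w P)) (h11 : ∀ P : B12.RunParams, Dag.B14_main (leavesP w P))
    (h12 : ∀ P : B12.RunParams, Dag.B15_main (leavesP w P))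
    (eM eP : FiniteEpsData F (SU N) → ℝ → ℝ) (hR : ∀ P : B12.RunParams, (w.up P).rOperation)
    (hcor : ∀ θ : Stage5Params F N, θ.Admissible → D = datumOfRecord₅ F N θ →
      ∃ R : B14Cor3.ReprFamily (datumOfRecord₅ F N θ).C,
        B14Cor3.LeafH (datumOfRecord₅ F N θ).C R w.γ ∧ B14Cor3.LeafU1 (datumOfRecord₅ F N θ).C R w.γ ∧
        B14Cor3.LeafU2 (datumOfRecord₅ F N θ).C R w.γ (eP D) ∧ B14Cor3.LeafL1 (datumOfRecord₅ F N θ).C R w.γ ∧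
        B14Cor3.LeafL2 (datumOfRecord₅ F N θ).C R w.γ (eM D))
    (hlo : FlowStep.BetaLowerH w.b γ₀ D.βfun) (hhi : FlowStep.BetaUpperH w.βup γ₀ D.βfun) :
    B16.EndStatementBPrinted D.C :=
  N24_at_record₅C_of_N13_exists h hγ₀ h03 h05 h06 h07 h08 h09 h10 h11 h12
    ⟨eM D, eP D, B16NodeKnitRecordPinned.b16_main_reExp_of_isRecordOfRecord₅C_pinned eM eP h hR hcor⟩ hlo hhi

/-- Module 7's `N24_at_record₅C_knit₁₃_of_prop26` with the 𝐑-slot pinned. [cite: Balaban1989LargeFieldII, Thm 1 p.355 + p.391; Balaban1984PropagatorsII, Prop. 2.6 (2.136)–(2.140) p.247; Balaban1988Convergent, Cor. 3 (2.50) p.264 (bookkeeping)] -/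
theorem N24_at_record₅C_knit₁₃_of_prop26_pinned (h : IsRecordOfRecord₅C F N D w) {γ₀ : ℝ} (hγ₀ : w.γ ≤ γ₀)
    (h26 : ∀ θ : Stage3Params, θ.toStage1Params.Admissible →
      B6.Prop26Printed (fun i : B6KLevelCensusIndexV1.KIdx θ.d₆ θ.ℓ₆ θ.hd' θ.hL' θ.b₀ θ.b₁ => B6KLevelCensusIndexV1.kGeoG i)
        (fun i => B6Prop26Census2136KLevelV1.kG i))
    (h05 : ∀ P : B12.RunParams, Dag.B8_main (leavesP w P))
    (h06 : ∀ P : B12.RunParams, Dag.B9_main (leavesP w P)) (h07 : ∀ P : B12.RunParams, Dag.B11_main (leavesP w P))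
    (h08 : ∀ P : B12.RunParams, Dag.B10_main (leavesP w P)) (h09 : ∀ P : B12.RunParams, Dag.B12_main (leavesP w P))
    (h10 : ∀ P : B12.RunParams, Dag.B13_main (leavesP w P)) (h11 : ∀ P : B12.RunParams, Dag.B14_main (leavesP w P))
    (h12 : ∀ P : B12.RunParams, Dag.B15_main (leavesP w P))
    (eM eP : FiniteEpsData F (SU N) → ℝ → ℝ) (hR : ∀ P : B12.RunParams, (w.up P).rOperation)
    (hcor : ∀ θ : Stage5Params F N, θ.Admissible → D = datumOfRecord₅ F N θ →
      ∃ R : B14Cor3.ReprFamily (datumOfRecord₅ F N θ).C,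
        B14Cor3.LeafH (datumOfRecord₅ F N θ).C R w.γ ∧ B14Cor3.LeafU1 (datumOfRecord₅ F N θ).C R w.γ ∧
        B14Cor3.LeafU2 (datumOfRecord₅ F N θ).C R w.γ (eP D) ∧ B14Cor3.LeafL1 (datumOfRecord₅ F N θ).C R w.γ ∧
        B14Cor3.LeafL2 (datumOfRecord₅ F N θ).C R w.γ (eM D))
    (hlo : FlowStep.BetaLowerH w.b γ₀ D.βfun) (hhi : FlowStep.BetaUpperH w.βup γ₀ D.βfun) :
    B16.EndStatementBPrinted D.C :=
  N24_at_record₅C_knit₁₃_pinned h hγ₀ (b6_main_of_isRecordOfRecord₅C_of_prop26 h26 h) h05 h06 h07 h08 h09 h10 h11 h12 eM eP hR hcor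
    hlo hhi

/-- **Module 9's `N24_at_record₅C_knit₀₈₁₀₁₁₁₃` with the 𝐑-slot PINNED**: N08 ∕ N10 ∕ N11 by their `₅C` knits (slots with the record's pin clause, verbatim), N13 by
the pinned re-exponent knit. [cite: Balaban1989LargeFieldII, Thm 1 p.355 + pp.387, 391; Balaban1985UV3, Thm 1 p.257 + Thm 2 p.272; Balaban1988RG2Cluster, Lemmas 1–3 pp.9, 11, 20; Balaban1988Convergent, Thm 1 p.262, Theorem p.245, p.244, Cor. 3 (2.50) p.264; Balaban1987RG1, (1.22) p.264 (bookkeeping)] -/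
theorem N24_at_record₅C_knit₀₈₁₀₁₁₁₃_pinned (h : IsRecordOfRecord₅C F N D w) {γ₀ : ℝ} (hγ₀ : w.γ ≤ γ₀)
    (h03 : ∀ P : B12.RunParams, Dag.B6_main (leavesP w P)) (h05 : ∀ P : B12.RunParams, Dag.B8_main (leavesP w P))
    (h06 : ∀ P : B12.RunParams, Dag.B9_main (leavesP w P)) (h07 : ∀ P : B12.RunParams, Dag.B11_main (leavesP w P))
    (h09 : ∀ P : B12.RunParams, Dag.B12_main (leavesP w P)) (h12 : ∀ P : B12.RunParams, Dag.B15_main (leavesP w P))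
    (slots₀₈ : ∀ θ : Stage5Params F N, θ.Admissible → D = datumOfRecord₅ F N θ →
      (∀ P, w.up P = upOfRecord₅C F N θ P) → ∀ P : B12.RunParams,
        ∃ (Xc : PrintedCarriersR) (I : Type) (C : B10Assembly.Consts) (T : I → B10.TowerRun),
          Nonempty (∀ i, B10Assembly.LeafSystem C (T i)) ∧ θ.res.X P = Xc.withTowerRuns10 T)
    (slots₁₀ : ∀ θ : Stage5Params F N, θ.Admissible → D = datumOfRecord₅ F N θ →
      (∀ P, w.up P = upOfRecord₅C F N θ P) → ∀ P : B12.RunParams,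
        B9LeafX (θ.res.Y P) →
          (B10.Thm1PrintedCompact (θ.res.X P).runs10 ∧ B10.Thm2Printed (θ.res.X P).runs10) →
            B11Leaf (θ.res.Z P) → B12Sec2to5.Lemma4Printed (θ.res.X P).F12 (θ.res.X P).c12 →
              B13.Lemma1Printed (θ.res.X P).S13 (θ.res.X P).c13 ∧ B13.Lemma2Printed (θ.res.X P).S13 (θ.res.X P).c13 ∧
                B13.Lemma3Printed (θ.res.X P).S13 (θ.res.X P).c13)
    (slots₁₁ : ∀ θ : Stage5Params F N, θ.Admissible → D = datumOfRecord₅ F N θ →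
      (∀ P, w.up P = upOfRecord₅C F N θ P) → ∀ P : B12.RunParams,
        ∃ S Scorr : (k : ℕ) → Density (F.P P.K) k (SU N) → Prop,
          (ROpLeaf (θ.res.V P) → B14.RAssumedP244 (θ.res.R P) Scorr S P.K) ∧
          (∀ k, k ≤ P.K → S k (densOfRecord₅ F N θ P k) → θ.res.S218 P k (densOfRecord₅ F N θ P k)) ∧
          ((leavesP w P).smallCouplings → S 0 (rhoZeroOfRecord F N P.K P.g0 (θ.res.E P))) ∧
          ((leavesP w P).b7 → (leavesP w P).b8 → (leavesP w P).b9 → (leavesP w P).b10 → (leavesP w P).b11 →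
            (leavesP w P).smallCouplings → (leavesP w P).smallFieldInductive → (leavesP w P).flowControl →
              ∀ k, k < P.K → S k (densOfRecord₅ F N θ P k) →
                Scorr (k + 1) (TrhoOfRecord F N P.K k (densOfRecord₅ F N θ P k))))
    (eM eP : FiniteEpsData F (SU N) → ℝ → ℝ) (hR : ∀ P : B12.RunParams, (w.up P).rOperation)
    (hcor : ∀ θ : Stage5Params F N, θ.Admissible → D = datumOfRecord₅ F N θ →
      ∃ R : B14Cor3.ReprFamily (datumOfRecord₅ F N θ).C,
        B14Cor3.LeafH (datumOfRecord₅ F N θ).C R w.γ ∧ B14Cor3.LeafU1 (datumOfRecord₅ F N θ).C R w.γ ∧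
        B14Cor3.LeafU2 (datumOfRecord₅ F N θ).C R w.γ (eP D) ∧ B14Cor3.LeafL1 (datumOfRecord₅ F N θ).C R w.γ ∧
        B14Cor3.LeafL2 (datumOfRecord₅ F N θ).C R w.γ (eM D))
    (hlo : FlowStep.BetaLowerH w.b γ₀ D.βfun) (hhi : FlowStep.BetaUpperH w.βup γ₀ D.βfun) :
    B16.EndStatementBPrinted D.C :=
  N24_at_record₅C_knit₁₃_pinned h hγ₀ h03 h05 h06 h07 (B10LeafUnpinnedRecord5C.b10_main_of_isRecordOfRecord₅C_of_slots h slots₀₈) h09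
    (B13NodeKnitRecord5C.b13_main_of_isRecordOfRecord₅C h slots₁₀) (B14NodeKnitRecord5C.b14_main_of_isRecordOfRecord₅C h slots₁₁) h12
    eM eP hR hcor hlo hhi

/-- Module 9's `…_of_prop26` with the 𝐑-slot pinned (N03 at its census). [cite: Balaban1989LargeFieldII, Thm 1 p.355 + p.391; Balaban1984PropagatorsII, Prop. 2.6 (2.136)–(2.140) p.247; Balaban1985UV3, Thm 1 p.257 + Thm 2 p.272; Balaban1988RG2Cluster, Lemmas 1–3 pp.9, 11, 20; Balaban1988Convergent, Thm 1 p.262, Cor. 3 (2.50) p.264 (bookkeeping)] -/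
theorem N24_at_record₅C_knit₀₈₁₀₁₁₁₃_of_prop26_pinned (h : IsRecordOfRecord₅C F N D w) {γ₀ : ℝ} (hγ₀ : w.γ ≤ γ₀)
    (h26 : ∀ θ : Stage3Params, θ.toStage1Params.Admissible →
      B6.Prop26Printed (fun i : B6KLevelCensusIndexV1.KIdx θ.d₆ θ.ℓ₆ θ.hd' θ.hL' θ.b₀ θ.b₁ => B6KLevelCensusIndexV1.kGeoG i)
        (fun i => B6Prop26Census2136KLevelV1.kG i))
    (h05 : ∀ P : B12.RunParams, Dag.B8_main (leavesP w P))
    (h06 : ∀ P : B12.RunParams, Dag.B9_main (leavesP w P)) (h07 : ∀ P : B12.RunParams, Dag.B11_main (leavesP w P))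
    (h09 : ∀ P : B12.RunParams, Dag.B12_main (leavesP w P)) (h12 : ∀ P : B12.RunParams, Dag.B15_main (leavesP w P))
    (slots₀₈ : ∀ θ : Stage5Params F N, θ.Admissible → D = datumOfRecord₅ F N θ →
      (∀ P, w.up P = upOfRecord₅C F N θ P) → ∀ P : B12.RunParams,
        ∃ (Xc : PrintedCarriersR) (I : Type) (C : B10Assembly.Consts) (T : I → B10.TowerRun),
          Nonempty (∀ i, B10Assembly.LeafSystem C (T i)) ∧ θ.res.X P = Xc.withTowerRuns10 T)
    (slots₁₀ : ∀ θ : Stage5Params F N, θ.Admissible → D = datumOfRecord₅ F N θ →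
      (∀ P, w.up P = upOfRecord₅C F N θ P) → ∀ P : B12.RunParams,
        B9LeafX (θ.res.Y P) →
          (B10.Thm1PrintedCompact (θ.res.X P).runs10 ∧ B10.Thm2Printed (θ.res.X P).runs10) →
            B11Leaf (θ.res.Z P) → B12Sec2to5.Lemma4Printed (θ.res.X P).F12 (θ.res.X P).c12 →
              B13.Lemma1Printed (θ.res.X P).S13 (θ.res.X P).c13 ∧ B13.Lemma2Printed (θ.res.X P).S13 (θ.res.X P).c13 ∧
                B13.Lemma3Printed (θ.res.X P).S13 (θ.res.X P).c13)
    (slots₁₁ : ∀ θ : Stage5Params F N, θ.Admissible → D = datumOfRecord₅ F N θ →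
      (∀ P, w.up P = upOfRecord₅C F N θ P) → ∀ P : B12.RunParams,
        ∃ S Scorr : (k : ℕ) → Density (F.P P.K) k (SU N) → Prop,
          (ROpLeaf (θ.res.V P) → B14.RAssumedP244 (θ.res.R P) Scorr S P.K) ∧
          (∀ k, k ≤ P.K → S k (densOfRecord₅ F N θ P k) → θ.res.S218 P k (densOfRecord₅ F N θ P k)) ∧
          ((leavesP w P).smallCouplings → S 0 (rhoZeroOfRecord F N P.K P.g0 (θ.res.E P))) ∧
          ((leavesP w P).b7 → (leavesP w P).b8 → (leavesP w P).b9 → (leavesP w P).b10 → (leavesP w P).b11 →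
            (leavesP w P).smallCouplings → (leavesP w P).smallFieldInductive → (leavesP w P).flowControl →
              ∀ k, k < P.K → S k (densOfRecord₅ F N θ P k) →
                Scorr (k + 1) (TrhoOfRecord F N P.K k (densOfRecord₅ F N θ P k))))
    (eM eP : FiniteEpsData F (SU N) → ℝ → ℝ) (hR : ∀ P : B12.RunParams, (w.up P).rOperation)
    (hcor : ∀ θ : Stage5Params F N, θ.Admissible → D = datumOfRecord₅ F N θ →
      ∃ R : B14Cor3.ReprFamily (datumOfRecord₅ F N θ).C,
        B14Cor3.LeafH (datumOfRecord₅ F N θ).C R w.γ ∧ B14Cor3.LeafU1 (datumOfRecord₅ F N θ).C R w.γ ∧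
        B14Cor3.LeafU2 (datumOfRecord₅ F N θ).C R w.γ (eP D) ∧ B14Cor3.LeafL1 (datumOfRecord₅ F N θ).C R w.γ ∧
        B14Cor3.LeafL2 (datumOfRecord₅ F N θ).C R w.γ (eM D))
    (hlo : FlowStep.BetaLowerH w.b γ₀ D.βfun) (hhi : FlowStep.BetaUpperH w.βup γ₀ D.βfun) :
    B16.EndStatementBPrinted D.C :=
  N24_at_record₅C_knit₀₈₁₀₁₁₁₃_pinned h hγ₀ (b6_main_of_isRecordOfRecord₅C_of_prop26 h26 h) h05 h06 h07 h09 h12 slots₀₈ slots₁₀ slots₁₁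
    eM eP hR hcor hlo hhi

/-- Module 9's «which child blocks» at `₅C` with the 𝐑-slot pinned: the FIVE pure binders N05 N06 N07 N09 N12 ⇒ (B2), given N03's census, N08 ∕ N10 ∕ N11's slots,
N13's world-leaf 𝐑 + exponent families + Cor.-3 leaves and the β-box. [cite: Balaban1989LargeFieldII, Thm 1 p.355 + p.391 (bookkeeping)] -/
theorem N24_binders₅C_after_knit_pinned (h : IsRecordOfRecord₅C F N D w) {γ₀ : ℝ} (hγ₀ : w.γ ≤ γ₀)
    (h26 : ∀ θ : Stage3Params, θ.toStage1Params.Admissible →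
      B6.Prop26Printed (fun i : B6KLevelCensusIndexV1.KIdx θ.d₆ θ.ℓ₆ θ.hd' θ.hL' θ.b₀ θ.b₁ => B6KLevelCensusIndexV1.kGeoG i)
        (fun i => B6Prop26Census2136KLevelV1.kG i))
    (slots₀₈ : ∀ θ : Stage5Params F N, θ.Admissible → D = datumOfRecord₅ F N θ →
      (∀ P, w.up P = upOfRecord₅C F N θ P) → ∀ P : B12.RunParams,
        ∃ (Xc : PrintedCarriersR) (I : Type) (C : B10Assembly.Consts) (T : I → B10.TowerRun),
          Nonempty (∀ i, B10Assembly.LeafSystem C (T i)) ∧ θ.res.X P = Xc.withTowerRuns10 T)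
    (slots₁₀ : ∀ θ : Stage5Params F N, θ.Admissible → D = datumOfRecord₅ F N θ →
      (∀ P, w.up P = upOfRecord₅C F N θ P) → ∀ P : B12.RunParams,
        B9LeafX (θ.res.Y P) →
          (B10.Thm1PrintedCompact (θ.res.X P).runs10 ∧ B10.Thm2Printed (θ.res.X P).runs10) →
            B11Leaf (θ.res.Z P) → B12Sec2to5.Lemma4Printed (θ.res.X P).F12 (θ.res.X P).c12 →
              B13.Lemma1Printed (θ.res.X P).S13 (θ.res.X P).c13 ∧ B13.Lemma2Printed (θ.res.X P).S13 (θ.res.X P).c13 ∧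
                B13.Lemma3Printed (θ.res.X P).S13 (θ.res.X P).c13)
    (slots₁₁ : ∀ θ : Stage5Params F N, θ.Admissible → D = datumOfRecord₅ F N θ →
      (∀ P, w.up P = upOfRecord₅C F N θ P) → ∀ P : B12.RunParams,
        ∃ S Scorr : (k : ℕ) → Density (F.P P.K) k (SU N) → Prop,
          (ROpLeaf (θ.res.V P) → B14.RAssumedP244 (θ.res.R P) Scorr S P.K) ∧
          (∀ k, k ≤ P.K → S k (densOfRecord₅ F N θ P k) → θ.res.S218 P k (densOfRecord₅ F N θ P k)) ∧
          ((leavesP w P).smallCouplings → S 0 (rhoZeroOfRecord F N P.K P.g0 (θ.res.E P))) ∧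
          ((leavesP w P).b7 → (leavesP w P).b8 → (leavesP w P).b9 → (leavesP w P).b10 → (leavesP w P).b11 →
            (leavesP w P).smallCouplings → (leavesP w P).smallFieldInductive → (leavesP w P).flowControl →
              ∀ k, k < P.K → S k (densOfRecord₅ F N θ P k) →
                Scorr (k + 1) (TrhoOfRecord F N P.K k (densOfRecord₅ F N θ P k))))
    (eM eP : FiniteEpsData F (SU N) → ℝ → ℝ) (hR : ∀ P : B12.RunParams, (w.up P).rOperation)
    (hcor : ∀ θ : Stage5Params F N, θ.Admissible → D = datumOfRecord₅ F N θ →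
      ∃ R : B14Cor3.ReprFamily (datumOfRecord₅ F N θ).C,
        B14Cor3.LeafH (datumOfRecord₅ F N θ).C R w.γ ∧ B14Cor3.LeafU1 (datumOfRecord₅ F N θ).C R w.γ ∧
        B14Cor3.LeafU2 (datumOfRecord₅ F N θ).C R w.γ (eP D) ∧ B14Cor3.LeafL1 (datumOfRecord₅ F N θ).C R w.γ ∧
        B14Cor3.LeafL2 (datumOfRecord₅ F N θ).C R w.γ (eM D))
    (hlo : FlowStep.BetaLowerH w.b γ₀ D.βfun) (hhi : FlowStep.BetaUpperH w.βup γ₀ D.βfun) :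
    ((∀ P : B12.RunParams, Dag.B8_main (leavesP w P)) → (∀ P : B12.RunParams, Dag.B9_main (leavesP w P)) →
      (∀ P : B12.RunParams, Dag.B11_main (leavesP w P)) → (∀ P : B12.RunParams, Dag.B12_main (leavesP w P)) →
      (∀ P : B12.RunParams, Dag.B15_main (leavesP w P)) → B16.EndStatementBPrinted D.C) :=
  fun h05 h06 h07 h09 h12 =>
    N24_at_record₅C_knit₀₈₁₀₁₁₁₃_of_prop26_pinned h hγ₀ h26 h05 h06 h07 h09 h12 slots₀₈ slots₁₀ slots₁₁ eM eP hR hcor hlo hhi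

/-! ## §3. At the Stage-8 record `₈C` (module 10's knits, 𝐑-slot pinned) -/

/-- **Module 10's `N24_at_record₈C_knit₀₈₁₀₁₁₁₃` with the 𝐑-slot PINNED** (β still at `D.βfun`). [cite: Balaban1989LargeFieldII, Thm 1 p.355 + pp.387, 391; Balaban1985UV3, Thm 1 p.257 + Thm 2 p.272; Balaban1988RG2Cluster, Lemmas 1–3 pp.9, 11, 20; Balaban1988Convergent, Thm 1 p.262, p.244, Cor. 3 (2.50) p.264 (bookkeeping)] -/
theorem N24_at_record₈C_knit₀₈₁₀₁₁₁₃_pinned (h : IsRecordOfRecord₈C F N D w) {γ₀ : ℝ} (hγ₀ : w.γ ≤ γ₀)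
    (h03 : ∀ P : B12.RunParams, Dag.B6_main (leavesP w P)) (h05 : ∀ P : B12.RunParams, Dag.B8_main (leavesP w P))
    (h06 : ∀ P : B12.RunParams, Dag.B9_main (leavesP w P)) (h07 : ∀ P : B12.RunParams, Dag.B11_main (leavesP w P))
    (h09 : ∀ P : B12.RunParams, Dag.B12_main (leavesP w P)) (h12 : ∀ P : B12.RunParams, Dag.B15_main (leavesP w P))
    (slots₀₈ : ∀ θ : Stage5Params F N, θ.Admissible → D = datumOfRecord₅ F N θ →
      (∀ P, w.up P = upOfRecord₅C F N θ P) → ∀ P : B12.RunParams,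
        ∃ (Xc : PrintedCarriersR) (I : Type) (C : B10Assembly.Consts) (T : I → B10.TowerRun),
          Nonempty (∀ i, B10Assembly.LeafSystem C (T i)) ∧ θ.res.X P = Xc.withTowerRuns10 T)
    (slots₁₀ : ∀ θ : Stage5Params F N, θ.Admissible → D = datumOfRecord₅ F N θ →
      (∀ P, w.up P = upOfRecord₅C F N θ P) → ∀ P : B12.RunParams,
        B9LeafX (θ.res.Y P) →
          (B10.Thm1PrintedCompact (θ.res.X P).runs10 ∧ B10.Thm2Printed (θ.res.X P).runs10) →
            B11Leaf (θ.res.Z P) → B12Sec2to5.Lemma4Printed (θ.res.X P).F12 (θ.res.X P).c12 →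
              B13.Lemma1Printed (θ.res.X P).S13 (θ.res.X P).c13 ∧ B13.Lemma2Printed (θ.res.X P).S13 (θ.res.X P).c13 ∧
                B13.Lemma3Printed (θ.res.X P).S13 (θ.res.X P).c13)
    (slots₁₁ : ∀ θ : Stage5Params F N, θ.Admissible → D = datumOfRecord₅ F N θ →
      (∀ P, w.up P = upOfRecord₅C F N θ P) → ∀ P : B12.RunParams,
        ∃ S Scorr : (k : ℕ) → Density (F.P P.K) k (SU N) → Prop,
          (ROpLeaf (θ.res.V P) → B14.RAssumedP244 (θ.res.R P) Scorr S P.K) ∧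
          (∀ k, k ≤ P.K → S k (densOfRecord₅ F N θ P k) → θ.res.S218 P k (densOfRecord₅ F N θ P k)) ∧
          ((leavesP w P).smallCouplings → S 0 (rhoZeroOfRecord F N P.K P.g0 (θ.res.E P))) ∧
          ((leavesP w P).b7 → (leavesP w P).b8 → (leavesP w P).b9 → (leavesP w P).b10 → (leavesP w P).b11 →
            (leavesP w P).smallCouplings → (leavesP w P).smallFieldInductive → (leavesP w P).flowControl →
              ∀ k, k < P.K → S k (densOfRecord₅ F N θ P k) →
                Scorr (k + 1) (TrhoOfRecord F N P.K k (densOfRecord₅ F N θ P k))))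
    (eM eP : FiniteEpsData F (SU N) → ℝ → ℝ) (hR : ∀ P : B12.RunParams, (w.up P).rOperation)
    (hcor : ∀ θ : Stage5Params F N, θ.Admissible → D = datumOfRecord₅ F N θ →
      ∃ R : B14Cor3.ReprFamily (datumOfRecord₅ F N θ).C,
        B14Cor3.LeafH (datumOfRecord₅ F N θ).C R w.γ ∧ B14Cor3.LeafU1 (datumOfRecord₅ F N θ).C R w.γ ∧
        B14Cor3.LeafU2 (datumOfRecord₅ F N θ).C R w.γ (eP D) ∧ B14Cor3.LeafL1 (datumOfRecord₅ F N θ).C R w.γ ∧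
        B14Cor3.LeafL2 (datumOfRecord₅ F N θ).C R w.γ (eM D))
    (hlo : FlowStep.BetaLowerH w.b γ₀ D.βfun) (hhi : FlowStep.BetaUpperH w.βup γ₀ D.βfun) :
    B16.EndStatementBPrinted D.C :=
  N24_at_record₅C_knit₀₈₁₀₁₁₁₃_pinned (isRecordOfRecord₅C_of_isRecordOfRecord₈C h) hγ₀ h03 h05 h06 h07 h09 h12 slots₀₈ slots₁₀ slots₁₁
    eM eP hR hcor hlo hhi

/-- **Module 10's `N24_at_record₈C_knit_of_betaMerged` with the 𝐑-slot PINNED** — the four children knit by name AND the β-binders displayed as bounds on the merged β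
of record along the world's box. [cite: Balaban1989LargeFieldII, Thm 1 p.355 + pp.387, 391; Balaban1987RG1, (1.20)–(1.22) p.264; Balaban1985UV3, Thm 1 p.257 + Thm 2 p.272; Balaban1988RG2Cluster, Lemmas 1–3 pp.9, 11, 20; Balaban1988Convergent, Thm 1 p.262, Cor. 3 (2.50) p.264 (bookkeeping)] -/
theorem N24_at_record₈C_knit_of_betaMerged_pinned (h : IsRecordOfRecord₈C F N D w)
    (h03 : ∀ P : B12.RunParams, Dag.B6_main (leavesP w P)) (h05 : ∀ P : B12.RunParams, Dag.B8_main (leavesP w P))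
    (h06 : ∀ P : B12.RunParams, Dag.B9_main (leavesP w P)) (h07 : ∀ P : B12.RunParams, Dag.B11_main (leavesP w P))
    (h09 : ∀ P : B12.RunParams, Dag.B12_main (leavesP w P)) (h12 : ∀ P : B12.RunParams, Dag.B15_main (leavesP w P))
    (slots₀₈ : ∀ θ : Stage5Params F N, θ.Admissible → D = datumOfRecord₅ F N θ →
      (∀ P, w.up P = upOfRecord₅C F N θ P) → ∀ P : B12.RunParams,
        ∃ (Xc : PrintedCarriersR) (I : Type) (C : B10Assembly.Consts) (T : I → B10.TowerRun),
          Nonempty (∀ i, B10Assembly.LeafSystem C (T i)) ∧ θ.res.X P = Xc.withTowerRuns10 T)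
    (slots₁₀ : ∀ θ : Stage5Params F N, θ.Admissible → D = datumOfRecord₅ F N θ →
      (∀ P, w.up P = upOfRecord₅C F N θ P) → ∀ P : B12.RunParams,
        B9LeafX (θ.res.Y P) →
          (B10.Thm1PrintedCompact (θ.res.X P).runs10 ∧ B10.Thm2Printed (θ.res.X P).runs10) →
            B11Leaf (θ.res.Z P) → B12Sec2to5.Lemma4Printed (θ.res.X P).F12 (θ.res.X P).c12 →
              B13.Lemma1Printed (θ.res.X P).S13 (θ.res.X P).c13 ∧ B13.Lemma2Printed (θ.res.X P).S13 (θ.res.X P).c13 ∧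
                B13.Lemma3Printed (θ.res.X P).S13 (θ.res.X P).c13)
    (slots₁₁ : ∀ θ : Stage5Params F N, θ.Admissible → D = datumOfRecord₅ F N θ →
      (∀ P, w.up P = upOfRecord₅C F N θ P) → ∀ P : B12.RunParams,
        ∃ S Scorr : (k : ℕ) → Density (F.P P.K) k (SU N) → Prop,
          (ROpLeaf (θ.res.V P) → B14.RAssumedP244 (θ.res.R P) Scorr S P.K) ∧
          (∀ k, k ≤ P.K → S k (densOfRecord₅ F N θ P k) → θ.res.S218 P k (densOfRecord₅ F N θ P k)) ∧
          ((leavesP w P).smallCouplings → S 0 (rhoZeroOfRecord F N P.K P.g0 (θ.res.E P))) ∧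
          ((leavesP w P).b7 → (leavesP w P).b8 → (leavesP w P).b9 → (leavesP w P).b10 → (leavesP w P).b11 →
            (leavesP w P).smallCouplings → (leavesP w P).smallFieldInductive → (leavesP w P).flowControl →
              ∀ k, k < P.K → S k (densOfRecord₅ F N θ P k) →
                Scorr (k + 1) (TrhoOfRecord F N P.K k (densOfRecord₅ F N θ P k))))
    (eM eP : FiniteEpsData F (SU N) → ℝ → ℝ) (hR : ∀ P : B12.RunParams, (w.up P).rOperation)
    (hcor : ∀ θ : Stage5Params F N, θ.Admissible → D = datumOfRecord₅ F N θ →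
      ∃ R : B14Cor3.ReprFamily (datumOfRecord₅ F N θ).C,
        B14Cor3.LeafH (datumOfRecord₅ F N θ).C R w.γ ∧ B14Cor3.LeafU1 (datumOfRecord₅ F N θ).C R w.γ ∧
        B14Cor3.LeafU2 (datumOfRecord₅ F N θ).C R w.γ (eP D) ∧ B14Cor3.LeafL1 (datumOfRecord₅ F N θ).C R w.γ ∧
        B14Cor3.LeafL2 (datumOfRecord₅ F N θ).C R w.γ (eM D))
    (hβm : ∀ θ : Stage8Params F N, θ.Admissible → D = datumOfRecord₅ F N (θ.toStage5 F N) → w.γ ≤ θ.γ →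
      letI := θ.instVβ₁; letI := θ.instVβ₂; letI := θ.instιβ
      FlowStep.BetaLowerH w.b w.γ (betaMerged F (mergedTermFamilyMat F N (chi7 F N θ) θ.εbg) θ.ρ8 θ.bV) ∧
        FlowStep.BetaUpperH w.βup w.γ (betaMerged F (mergedTermFamilyMat F N (chi7 F N θ) θ.εbg) θ.ρ8 θ.bV)) :
    B16.EndStatementBPrinted D.C := by
  obtain ⟨θ, hθ, hD, -, hγ, -, -⟩ := id h
  obtain ⟨hlo, hhi⟩ := hβm θ hθ hD hγ.2
  exact N24_at_record₈C_knit₀₈₁₀₁₁₁₃_pinned h le_rfl h03 h05 h06 h07 h09 h12 slots₀₈ slots₁₀ slots₁₁ eM eP hR hcor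
    ((N24_betaLowerH_iff_merged₈ θ hD hγ.2).mpr hlo) ((N24_betaUpperH_iff_merged₈ θ hD hγ.2).mpr hhi)

/-- Module 10's «which child blocks» at `₈C` with the 𝐑-slot pinned: the FIVE pure binders N05 N06 N07 N09 N12 ⇒ (B2), given N03's census, N08 ∕ N10 ∕ N11's slots, N13's
world-leaf 𝐑 + exponent families + Cor.-3 leaves and the two bounds on the merged β of record along `]0, w.γ]^{k+1}`. [cite: Balaban1989LargeFieldII, Thm 1 p.355 + p.391; Balaban1987RG1, (1.20)–(1.22) p.264 (bookkeeping)] -/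
theorem N24_binders₈C_after_knit_pinned (h : IsRecordOfRecord₈C F N D w)
    (h26 : ∀ θ : Stage3Params, θ.toStage1Params.Admissible →
      B6.Prop26Printed (fun i : B6KLevelCensusIndexV1.KIdx θ.d₆ θ.ℓ₆ θ.hd' θ.hL' θ.b₀ θ.b₁ => B6KLevelCensusIndexV1.kGeoG i)
        (fun i => B6Prop26Census2136KLevelV1.kG i))
    (slots₀₈ : ∀ θ : Stage5Params F N, θ.Admissible → D = datumOfRecord₅ F N θ →
      (∀ P, w.up P = upOfRecord₅C F N θ P) → ∀ P : B12.RunParams,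
        ∃ (Xc : PrintedCarriersR) (I : Type) (C : B10Assembly.Consts) (T : I → B10.TowerRun),
          Nonempty (∀ i, B10Assembly.LeafSystem C (T i)) ∧ θ.res.X P = Xc.withTowerRuns10 T)
    (slots₁₀ : ∀ θ : Stage5Params F N, θ.Admissible → D = datumOfRecord₅ F N θ →
      (∀ P, w.up P = upOfRecord₅C F N θ P) → ∀ P : B12.RunParams,
        B9LeafX (θ.res.Y P) →
          (B10.Thm1PrintedCompact (θ.res.X P).runs10 ∧ B10.Thm2Printed (θ.res.X P).runs10) →
            B11Leaf (θ.res.Z P) → B12Sec2to5.Lemma4Printed (θ.res.X P).F12 (θ.res.X P).c12 →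
              B13.Lemma1Printed (θ.res.X P).S13 (θ.res.X P).c13 ∧ B13.Lemma2Printed (θ.res.X P).S13 (θ.res.X P).c13 ∧
                B13.Lemma3Printed (θ.res.X P).S13 (θ.res.X P).c13)
    (slots₁₁ : ∀ θ : Stage5Params F N, θ.Admissible → D = datumOfRecord₅ F N θ →
      (∀ P, w.up P = upOfRecord₅C F N θ P) → ∀ P : B12.RunParams,
        ∃ S Scorr : (k : ℕ) → Density (F.P P.K) k (SU N) → Prop,
          (ROpLeaf (θ.res.V P) → B14.RAssumedP244 (θ.res.R P) Scorr S P.K) ∧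
          (∀ k, k ≤ P.K → S k (densOfRecord₅ F N θ P k) → θ.res.S218 P k (densOfRecord₅ F N θ P k)) ∧
          ((leavesP w P).smallCouplings → S 0 (rhoZeroOfRecord F N P.K P.g0 (θ.res.E P))) ∧
          ((leavesP w P).b7 → (leavesP w P).b8 → (leavesP w P).b9 → (leavesP w P).b10 → (leavesP w P).b11 →
            (leavesP w P).smallCouplings → (leavesP w P).smallFieldInductive → (leavesP w P).flowControl →
              ∀ k, k < P.K → S k (densOfRecord₅ F N θ P k) →
                Scorr (k + 1) (TrhoOfRecord F N P.K k (densOfRecord₅ F N θ P k))))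
    (eM eP : FiniteEpsData F (SU N) → ℝ → ℝ) (hR : ∀ P : B12.RunParams, (w.up P).rOperation)
    (hcor : ∀ θ : Stage5Params F N, θ.Admissible → D = datumOfRecord₅ F N θ →
      ∃ R : B14Cor3.ReprFamily (datumOfRecord₅ F N θ).C,
        B14Cor3.LeafH (datumOfRecord₅ F N θ).C R w.γ ∧ B14Cor3.LeafU1 (datumOfRecord₅ F N θ).C R w.γ ∧
        B14Cor3.LeafU2 (datumOfRecord₅ F N θ).C R w.γ (eP D) ∧ B14Cor3.LeafL1 (datumOfRecord₅ F N θ).C R w.γ ∧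
        B14Cor3.LeafL2 (datumOfRecord₅ F N θ).C R w.γ (eM D))
    (hβm : ∀ θ : Stage8Params F N, θ.Admissible → D = datumOfRecord₅ F N (θ.toStage5 F N) → w.γ ≤ θ.γ →
      letI := θ.instVβ₁; letI := θ.instVβ₂; letI := θ.instιβ
      FlowStep.BetaLowerH w.b w.γ (betaMerged F (mergedTermFamilyMat F N (chi7 F N θ) θ.εbg) θ.ρ8 θ.bV) ∧
        FlowStep.BetaUpperH w.βup w.γ (betaMerged F (mergedTermFamilyMat F N (chi7 F N θ) θ.εbg) θ.ρ8 θ.bV)) :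
    ((∀ P : B12.RunParams, Dag.B8_main (leavesP w P)) → (∀ P : B12.RunParams, Dag.B9_main (leavesP w P)) →
      (∀ P : B12.RunParams, Dag.B11_main (leavesP w P)) → (∀ P : B12.RunParams, Dag.B12_main (leavesP w P)) →
      (∀ P : B12.RunParams, Dag.B15_main (leavesP w P)) → B16.EndStatementBPrinted D.C) := by
  intro h05 h06 h07 h09 h12
  obtain ⟨θ, hθ, hD, -, hγ, -, -⟩ := id h
  obtain ⟨hlo, hhi⟩ := hβm θ hθ hD hγ.2
  exact N24_at_record₅C_knit₀₈₁₀₁₁₁₃_of_prop26_pinned (isRecordOfRecord₅C_of_isRecordOfRecord₈C h) le_rfl h26 h05 h06 h07 h09 h12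
    slots₀₈ slots₁₀ slots₁₁ eM eP hR hcor ((N24_betaLowerH_iff_merged₈ θ hD hγ.2).mpr hlo)
    ((N24_betaUpperH_iff_merged₈ θ hD hγ.2).mpr hhi)

end Literature.MathematicalPhysics.QuantumFieldTheory.Balaban1983to89.Node00

end
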